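import Summits.ResolutionOfSingularities.ResolutionOfSingularities.Theorems.WildConesCampaignW46HypersurfacesCharTwoSidewaysExit
import Summits.ResolutionOfSingularities.ResolutionOfSingularities.Theorems.WildConesCampaignW46HypersurfacesCharTwoFourfoldMixed

/-!
# [OURS · L1 W4.6, rung (ii) at p = 2, n = 4] ORDER-2-CLEANED FOURFOLD DOUBLE POINTS `z² = a(u₀,…,u₃)`: the
# one-step behaviour is decided by `h₂` ALONE — successor isolated iff `h₂ ≤ 2` (every field of
# characteristic 2)

HONEST FRAMING. Everything here is OURS: corollaries, for `n = 4`, of the every-`n` theory of this seat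
(`…IsolTransfer.lean` p514670, `…SidewaysExit.lean` p518449) and of gen 3's fourfold facts
(`…FourfoldMixed.lean` p507619: an order-2-cleaned fourfold double state with a double successor has
`e = 2`). Route WildCones' TYPED dynamics (`Theorems/WildConesClassicalRegimesDefs.lean`); nothing here is a
statement of H. Hironaka's manuscript [Hironaka2017]; no FACT-LIST premise. AI review is weaker than expert
review. Cell res-hironaka (LADDER-RESOLUTION rung L, D-0089), slot W4.6, seat res-L1-s46-pv-4 (gen 4); host
route `WildCones`, crux `ClassicalRegimes` (stmt-ResolutionOfSingularities-16884, proved); `--supports …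
--as helper`.

WHY. Gen 2 showed that the threefold regime `MultP ∧ OrdP ∧ Isol` is NOT closed for fourfolds
(`fourfold_splittingRegime_not_closed`, p485483) and gen 3 that `e = 2` «decides nothing» there (p507619).
For fourfolds `e ∈ {0, 2, 4}` and `OrdP ⇔ e ≤ 2`; an `e = 0` state has no double successor. So for an
ISOLATED ORDER-2-CLEANED FOURFOLD DOUBLE POINT with a double successor, `e = 2` and the gen-4 criterion
reads: **successor isolated ⇔ `h₂(c) ≤ 2`** (`fourfold_isol_step_iff`), non-isolated ⇔ `h₂(c) = 3`; and
along every branch the forced regime is left within `μ` blow-ups either by a multiplicity drop or, sideways,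
right after an `h₂ = 3` state (`fourfold_exit_classification`).

References: H. Hironaka, ms. 2017-03-23 [Hironaka2017] — ROLE only (Th. 16.6 p.84, Th. 16.13 p.87), under
adjudication, never as fact; G.-M. Greuel, G. Pfister [GreuelPfister2026] (context).
-/

noncomputable section

-- single-problem summit: the doubled namespace component `ResolutionOfSingularities` is forced
set_option linter.dupNamespace false

open scoped BigOperators Classical

open MvPowerSeries IsLocalRing

open Literature.AlgebraicGeometry.Resolution

namespace Summit.ResolutionOfSingularities.ResolutionOfSingularities.Theorems

namespace CampaignW46.HypersurfacesCharTwo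

open WildCones WildCones.MuDropCharTwoOrdP ThreefoldsCharTwo

variable {κ : Type} [Field κ]

/-- [OURS · L1 W4.6 rung (ii) at `p = 2`, `n = 4`; NOT a statement of the manuscript] **ORDER-2-CLEANED
FOURFOLD DOUBLE POINTS: successor isolated iff `h₂ ≤ 2`.** For an isolated double state of
`z² = a(u₀,u₁,u₂,u₃)` (any field of characteristic `2`) with a hyperbolic pair in its cleaned quadratic form
(`OrdP`) and a chart/translation whose successor is a double point: the successor is isolated iff
`h₂(c) ≤ 2` (the residual plane germ has a tangent cubic). [folklore] -/
theorem fourfold_isol_step_iff [CharP κ 2] (c : (Fin 4 → ℕ) → κ) (i : Fin 4) (τ : Fin 4 → κ)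
    (hM : MultP 2 4 κ c) (hO : OrdP 2 4 κ c) (hI : Isol 2 4 κ c) (hM' : MultP 2 4 κ (step 2 4 κ i τ c)) :
    Isol 2 4 κ (step 2 4 κ i τ c) ↔ milnorHilbertTwo 2 4 κ c ≤ 2 :=
  hypersurface_isol_step_iff_of_milnorEmbDim_eq_two c i τ hM hI
    (fourfold_milnorEmbDim_eq_two_of_double_successor c i τ hM hO hM') hM'

/-- [OURS · L1 W4.6 rung (ii) at `p = 2`, `n = 4`; NOT a statement of the manuscript] … and the successor
is NON-isolated iff `h₂(c) = 3` (no tangent cubic). [folklore] -/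
theorem fourfold_not_isol_step_iff [CharP κ 2] (c : (Fin 4 → ℕ) → κ) (i : Fin 4) (τ : Fin 4 → κ)
    (hM : MultP 2 4 κ c) (hO : OrdP 2 4 κ c) (hI : Isol 2 4 κ c) (hM' : MultP 2 4 κ (step 2 4 κ i τ c)) :
    ¬ Isol 2 4 κ (step 2 4 κ i τ c) ↔ milnorHilbertTwo 2 4 κ c = 3 := by
  have he := fourfold_milnorEmbDim_eq_two_of_double_successor c i τ hM hO hM'
  rw [hypersurface_not_isol_step_iff c i τ hM hI he.le hM']
  exact ⟨fun h => h.2, fun h => ⟨he, h⟩⟩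

/-- [OURS · L1 W4.6 rung (ii) at `p = 2`, `n = 4`; NOT a statement of the manuscript] **HOW AN ORDER-2-CLEANED
FOURFOLD DOUBLE POINT LEAVES THE FORCED REGIME**: from an isolated `OrdP` double state `c₀` of
`z² = a(u₀,…,u₃)`, along every chart word and translation word there is `m ≤ μ(c₀)` with all earlier
states isolated double points and the state `m` either of multiplicity `< 2` or a non-isolated double
point preceded by a state with `(e, h₂) = (2, 3)`. [folklore] -/
theorem fourfold_exit_classification [CharP κ 2] (c₀ : (Fin 4 → ℕ) → κ) (i : ℕ → Fin 4)
    (t : ℕ → Fin 4 → κ) (hM₀ : MultP 2 4 κ c₀) (hO₀ : OrdP 2 4 κ c₀) (hI₀ : Isol 2 4 κ c₀) :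
    ∃ m ≤ mu 2 4 κ c₀,
      (∀ k < m, MultP 2 4 κ (run 2 4 κ c₀ i t k) ∧ Isol 2 4 κ (run 2 4 κ c₀ i t k)) ∧
      (¬ MultP 2 4 κ (run 2 4 κ c₀ i t m) ∨
        (MultP 2 4 κ (run 2 4 κ c₀ i t m) ∧ ¬ Isol 2 4 κ (run 2 4 κ c₀ i t m) ∧ 1 ≤ m ∧
          milnorEmbDim 2 4 κ (run 2 4 κ c₀ i t (m - 1)) = 2 ∧
          milnorHilbertTwo 2 4 κ (run 2 4 κ c₀ i t (m - 1)) = 3)) :=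
  hypersurface_exit_classification c₀ i t hI₀
    (by have h := (ordP_iff_milnorEmbDim_add_two_le hM₀).mp hO₀; omega)

end CampaignW46.HypersurfacesCharTwo

end Summit.ResolutionOfSingularities.ResolutionOfSingularities.Theorems

end
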